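import Summits.BirchSwinnertonDyer.BirchSwinnertonDyer.Theorems.EisensteinPrimesBSDpOnCellCTelescopeK2WeightTwoControlMapOfFiniteDefect
import Summits.BirchSwinnertonDyer.BirchSwinnertonDyer.Theorems.EisensteinPrimesBSDpOnCellCTelescopeK2InertiaDefectFiniteOfFibres
import Summits.BirchSwinnertonDyer.BirchSwinnertonDyer.Theorems.EisensteinPrimesBSDpOnCellCTelescopeK2InertiaDefectGenericFibre
import Summits.BirchSwinnertonDyer.BirchSwinnertonDyer.Theorems.EisensteinPrimesBSDpOnCellCTelescopeK2FixedTorsionGenericFibre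
import Summits.BirchSwinnertonDyer.BirchSwinnertonDyer.Theorems.EisensteinPrimesBSDpOnCellCTelescopeK2FibreCofinite
import HarnessLib

/-!
# Crux 4 `BSDpOnCellC` (stmt-BirchSwinnertonDyer-19034), line `telescope`, leaf N3′ `stub_memberControlMod` — the MEMBER CONTROL MAP
# `X₂/π_k X₂ → Sel(M₂[π_k])^∨` (`π_k = C(X − C x_k)`) with kernel killed by a POWER OF `p` and finite cokernel, for ALL BUT FINITELY MANY
# members `k`, from N1's fibre data + the weight-two Cell-C input + (dist) — no per-member arithmetic input
# (helper, `--supports stmt-BirchSwinnertonDyer-19034 --as helper`; closes nothing)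

Cell `bsd-eis`, width seat `bsd-line-x2-p2` (prover g21, 2026-08-30; D-0154 KEY row 5). THEOREMS ONLY: no definition, no named fact,
no `sorry`, no instance, no notation. The control half of N3′'s (ctrl_k) — which, being a char-ideal CONTAINMENT, needs the control cokernel
to have `p`-POWER characteristic ideal (memo #46 §4) — assembled for cofinitely many `k` from this seat's generic-fibre theorems:

* §1 **`exists_memberControlMap_of_finiteDefects`** — per member `k`: p751755
  `TelescopeK2ControlOfFrobeniusData.exists_quotSMulTop_XBig_linearMap_of_frobeniusData` at `c = X − C x_k` with the DEGENERATE Frobenius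
  datum `(1, 0, C(p^n))` at EVERY ramified `w ∤ p` (inputs: (tor) + `p`-primarity ⇒ `π_k`-power torsion
  (`TelescopeK2GlobalDefectInputs.exists_pow_sub_C_smul_eq_zero`), (cof_k), the member fixed part at `𝔭bar`
  «`{a | π_k•a = 0 ∧ a fixed by ker κ|_{D_𝔭bar}}` finite», and (fin_{w,k}) at each `w ∈ S₀`, `w ∤ p`); conclusion
  `∃ α : X^∅_𝔭bar/(C π_k) →ₗ Sel(M₂[C π_k])^∨` whose KERNEL IS KILLED BY A POWER OF `p` (so prime to `C π_k`) and whose cokernel is finite —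
  the control scalar is `C(p^m)`, no `P_w((1+T)^{N_w})` factors (Heegner / (deg₁) / (ann) not used).
* §2 **`finite_setOf_not_memberControl`** — ALL BUT FINITELY MANY `k`: for `A₂` cofinitely generated, `x` injective on `𝒦`, (cof_k) on `𝒦`,
  and the WEIGHT-TWO fixed part at `𝔭bar` finite (x2-p2 g20 p756140 on Cell C), the two per-member inputs of §1 hold for all but
  finitely many `k ∈ 𝒦` (`TelescopeK2FixedTorsionGenericFibre.finite_setOf_not_finite_fixed_torsionBy`,
  `TelescopeK2InertiaDefectGenericFibre.finite_setOf_not_finite_inertiaDefect` at the finitely many `w ∈ S₀`), hence so does §1's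
  conclusion.
* §3 **`finite_setOf_not_memberControl_of_cellC`** — road-prefix currency (`CellC W p`, IQF `K`, `p` split, `κ` anticyclotomic, `𝔭bar`,
  N1's (tor)/(cof_k)/(unr `S₀` ARBITRARY)/(fd₀), (dist)): §2 with the weight-two fixed part from p756140/p756368 and `…FibreCofinite`.

BY NAME: the Selmer-control half of N3′'s (ctrl_k) is a THEOREM for cofinitely many members (the transport along (fd_k) and the
char-ideal bookkeeping remain; as TYPED — ∀ k, `S₀` arbitrary — N3′ needs member facts not in FD, memo #46 §4). HONEST FRAMING: assembly
over binders; nothing about any curve's BSD is asserted; no registered stub, crux or summit statement is proved by this file; closes: none.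

References: [JetchevSkinnerWan2017] Lemma 3.4.1; [Castella2018Erratum] Lemma 2.1; [GreenbergLNM1716] §1 p. 61, §4 pp. 117–125; [Greenberg2006] §3 A.
-/

noncomputable section

-- D-0017: single-problem summit, the namespace repeats the problem name by design.
set_option linter.dupNamespace false
set_option autoImplicit false

open Field IsDedekindDomain NumberField WeierstrassCurve
open Literature.NumberTheory.GaloisRepresentations Literature.NumberTheory.EllipticCurves
  Literature.NumberTheory.EllipticCurves.BigRepModule Literature.NumberTheory.EllipticCurves.BigGaloisRep
open Literature.NumberTheory.IwasawaTheory Literature.NumberTheory.IwasawaTheory.Greenberg2006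
open Summit.BirchSwinnertonDyer.Rank1Residual.X11b
open scoped Pointwise

namespace Summit.BirchSwinnertonDyer.BirchSwinnertonDyer.Theorems.TelescopeK2MemberControlMapEventually

variable {K : Type} [Field K] [NumberField K] {p : ℕ} [Fact p.Prime]

/-! ## §1 The member control map from per-member finiteness inputs -/

/-- `C(X − C x) ∤ C(p^m)` in `ℤ_p⟦X⟧⟦T⟧` for `x ∈ 𝔪`. [cite: GreenbergLNM1716, §4 p. 115 (`ker σ_s = (θ_s)`)] -/
theorem not_C_X_sub_C_dvd_C_pow {x : ℤ_[p]} (hx : ‖x‖ < 1) (m : ℕ) :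
    ¬ ((PowerSeries.C (PowerSeries.X - PowerSeries.C x : PowerSeries ℤ_[p]) : PowerSeries (PowerSeries ℤ_[p])) ∣
      PowerSeries.C ((p : PowerSeries ℤ_[p]) ^ m)) := by
  intro h
  have h1 := TelescopeK2ControlOfCoefficients.dvd_of_C_dvd_C h
  rw [← Nat.cast_pow, ← map_natCast (PowerSeries.C (R := ℤ_[p]))] at h1
  have h2 := IwasawaAlgebra.eq_zero_of_X_sub_C_dvd_C p (PadicInt.mem_nonunits.2 hx) h1
  exact pow_ne_zero m (Nat.cast_ne_zero.2 (Nat.Prime.ne_zero Fact.out)) (by exact_mod_cast h2)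

/-- The control scalar of the degenerate Frobenius data is a constant power: `C(q^a) · ∏_i (C(q^{n_i}))(y_i) = C(q^{a + Σ n_i})`.
[folklore] -/
theorem C_pow_mul_prod_aeval_C {𝒪 : Type*} [CommRing 𝒪] {ι : Type*} (s : Finset ι) (y : ι → PowerSeries 𝒪) (q : 𝒪)
    (a : ℕ) (n : ι → ℕ) :
    (PowerSeries.C (q ^ a) : PowerSeries 𝒪) * ∏ i ∈ s, (Polynomial.aeval (y i) (Polynomial.C (q ^ n i)) : PowerSeries 𝒪) =
      PowerSeries.C (q ^ (a + ∑ i ∈ s, n i)) := by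
  classical
  have hfac : ∀ i ∈ s, (Polynomial.aeval (y i) (Polynomial.C (q ^ n i)) : PowerSeries 𝒪) = PowerSeries.C (q ^ n i) :=
    fun i _ => by
    rw [Polynomial.aeval_C]
    exact PowerSeries.algebraMap_apply.trans (by rw [Algebra.algebraMap_self, RingHom.id_apply])
  rw [Finset.prod_congr rfl hfac, ← map_prod, ← map_mul, Finset.prod_pow_eq_pow_sum, ← pow_add]

set_option maxHeartbeats 800000 in
/-- **THE MEMBER CONTROL MAP FROM PER-MEMBER FINITENESS.** `K` imaginary quadratic, `p ≠ 2`, `κ` anticyclotomic, `𝔭bar ∋ p`; `ρ₂` on a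
`p`-primary `X`-power-torsion `A₂`, a member point `x_k ∈ 𝔪` with (cof_k); (unr `S₀`); the member fixed part at `𝔭bar` finite; and at every
`w ∈ S₀`, `w ∤ p`, the member inertia defect `A₂^{I_w}/π_k·A₂^{I_w}` killed by a power of `p`. THEN there is a `Λ`-linear
`α : X^∅_𝔭bar/(C π_k) → Sel(M₂[C π_k])^∨` whose kernel is killed by ONE POWER OF `p` and whose cokernel is finite.
[cite: JetchevSkinnerWan2017, §3.4, Lemma 3.4.1 (arXiv:1512.06894 p. 14)] [cite: Castella2018Erratum, Lemma 2.1 (p. 2)] [cite: Brink2007, Cor. 1] -/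
theorem exists_memberControlMap_of_finiteDefects
    (hK : IsImaginaryQuadratic K) (hp2 : p ≠ 2)
    (κ : ZpExtension K p) (hκ : κ.IsAnticyclotomic)
    (𝔭bar : HeightOneSpectrum (𝓞 K)) (h𝔭bar : ((p : ℕ) : 𝓞 K) ∈ 𝔭bar.asIdeal)
    [TopologicalSpace (PowerSeries ℤ_[p])] (A₂ : Type) [AddCommGroup A₂] [Module (PowerSeries ℤ_[p]) A₂]
    [TopologicalSpace A₂] [DiscreteTopology A₂]
    (ρ₂ : ContinuousRep (absoluteGaloisGroup K) (PowerSeries ℤ_[p]) A₂)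
    [TopologicalSpace (PowerSeries (PowerSeries ℤ_[p]))]
    [ContinuousSMul (PowerSeries (PowerSeries ℤ_[p])) (BigRepModule (PowerSeries ℤ_[p]) p A₂)]
    (htor : ∀ a : A₂, ∃ n : ℕ, (PowerSeries.X : PowerSeries ℤ_[p]) ^ n • a = 0)
    (hprim : ∀ a : A₂, ∃ k : ℕ, p ^ k • a = 0)
    {x : ℤ_[p]} (hx : ‖x‖ < 1)
    (hcof : ∀ a : A₂, ∃ b : A₂, (PowerSeries.X - PowerSeries.C x) • b = a)
    (S₀ : Finset (HeightOneSpectrum (𝓞 K))) (hunr : GaloisRep.IsUnramifiedOutside (S₀ : Set (HeightOneSpectrum (𝓞 K))) ρ₂)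
    (hfin𝔮 : Set.Finite {a : A₂ | (PowerSeries.X - PowerSeries.C x) • a = 0 ∧ ∀ τ : LocalGroup K (Sum.inl 𝔭bar),
      κ (localMap K (Sum.inl 𝔭bar) τ) = 1 → ρ₂ (localMap K (Sum.inl 𝔭bar) τ) a = a})
    (hfinI : ∀ w ∈ S₀, ((p : ℕ) : 𝓞 K) ∉ w.asIdeal →
      ∃ n : ℕ, ∀ a : A₂, (∀ h : LocalGroup K (Sum.inr w), ρ₂ (localMap K (Sum.inr w) h) a = a) →
        ∃ a₀ : A₂, (∀ h : LocalGroup K (Sum.inr w), ρ₂ (localMap K (Sum.inr w) h) a₀ = a₀) ∧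
          (PowerSeries.X - PowerSeries.C x) • a₀ = ((p : PowerSeries ℤ_[p]) ^ n) • a) :
    ∃ α : QuotSMulTop (PowerSeries.C (PowerSeries.X - PowerSeries.C x : PowerSeries ℤ_[p]))
          (XBig κ ρ₂ 𝔭bar (∅ : Set (HeightOneSpectrum (𝓞 K))))
        →ₗ[PowerSeries (PowerSeries ℤ_[p])]
        CharacterModule (TorsionControl.selmer (localMap K) (strictSet p 𝔭bar (∅ : Set (HeightOneSpectrum (𝓞 K))))
          (TorsionControl.torsionRep (AnticyclotomicBigGaloisRep κ ρ₂)
            (PowerSeries.C (PowerSeries.X - PowerSeries.C x : PowerSeries ℤ_[p])))),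
      (∃ m : ℕ, ∀ v ∈ LinearMap.ker α, (PowerSeries.C ((p : PowerSeries ℤ_[p]) ^ m) : PowerSeries (PowerSeries ℤ_[p])) • v = 0) ∧
      (∀ v ∈ LinearMap.ker α, ∃ s : PowerSeries (PowerSeries ℤ_[p]),
        ¬ ((PowerSeries.C (PowerSeries.X - PowerSeries.C x : PowerSeries ℤ_[p])) ∣ s) ∧ s • v = 0) ∧
      Finite ((CharacterModule (TorsionControl.selmer (localMap K) (strictSet p 𝔭bar (∅ : Set (HeightOneSpectrum (𝓞 K))))
        (TorsionControl.torsionRep (AnticyclotomicBigGaloisRep κ ρ₂)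
          (PowerSeries.C (PowerSeries.X - PowerSeries.C x : PowerSeries ℤ_[p]))))) ⧸ LinearMap.range α) := by
  classical
  set π : PowerSeries ℤ_[p] := PowerSeries.X - PowerSeries.C x with hπ
  -- torsion data at `c = π`
  have htors : ∀ a : A₂, IsOfFinAddOrder a := fun a => by
    obtain ⟨k, hk⟩ := hprim a
    exact (isOfFinAddOrder_iff_nsmul_eq_zero).2 ⟨p ^ k, pow_pos (Nat.Prime.pos Fact.out) k, hk⟩
  have htorπ : ∀ a : A₂, (∃ k : ℕ, p ^ k • a = 0) → ∃ n : ℕ, π ^ n • a = 0 := fun a ha =>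
    TelescopeK2GlobalDefectInputs.exists_pow_sub_C_smul_eq_zero x hx a (htor a) ha
  have hroot : ∀ a : A₂, (∃ k : ℕ, p ^ k • a = 0) → ∃ b : A₂, (∃ k : ℕ, p ^ k • b = 0) ∧ π • b = a :=
    TelescopeK2BigRepDivisible.exists_primaryRoot_of_divisible π hcof htors
  -- open image at `𝔭bar` and the global fixed part
  obtain ⟨s, hsurj⟩ :=
    AnticyclotomicLocalImage.anticyclotomic_exists_forall_exists_toAdd_eq_pow_mul hK hp2 κ hκ 𝔭bar h𝔭bar
  have hfinK := TelescopeK2FixedTorsionFiniteSplitMult.finite_fixed_torsionBy_global_of_local κ ρ₂ π 𝔭bar hfin𝔮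
  -- the degenerate Frobenius datum at EVERY ramified `w ∤ p`
  set S₁ : Finset (HeightOneSpectrum (𝓞 K)) := S₀.filter (fun w => ((p : ℕ) : 𝓞 K) ∉ w.asIdeal) with hS₁
  have hmem : ∀ w ∈ S₁, w ∈ S₀ ∧ ((p : ℕ) : 𝓞 K) ∉ w.asIdeal := fun w hw => Finset.mem_filter.1 hw
  let nI : HeightOneSpectrum (𝓞 K) → ℕ := fun w => if hw : w ∈ S₁ then Classical.choose (hfinI w (hmem w hw).1 (hmem w hw).2) else 0
  have hnI : ∀ w ∈ S₁, ∀ a : A₂, (∀ h : LocalGroup K (Sum.inr w), ρ₂ (localMap K (Sum.inr w) h) a = a) →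
      ∃ a₀ : A₂, (∀ h : LocalGroup K (Sum.inr w), ρ₂ (localMap K (Sum.inr w) h) a₀ = a₀) ∧
        π • a₀ = ((p : PowerSeries ℤ_[p]) ^ nI w) • a := fun w hw => by
    simp only [nI, dif_pos hw]
    exact Classical.choose_spec (hfinI w (hmem w hw).1 (hmem w hw).2)
  have hN : ∀ w ∈ S₁, (κ (localMap K (Sum.inl w) ((fun _ => (1 : LocalGroup K (Sum.inl w))) w))).toAdd =
      (((fun _ => (0 : ℕ)) w : ℕ) : ℤ_[p]) := fun w _ => by
    show (κ (localMap K (Sum.inl w) 1)).toAdd = ((0 : ℕ) : ℤ_[p])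
    rw [map_one, map_one, Nat.cast_zero]
    rfl
  have hP : ∀ w ∈ S₁, ∀ a : A₂, (∀ h : LocalGroup K (Sum.inr w), ρ₂ (localMap K (Sum.inr w) h) a = a) →
      ∃ a₀ : A₂, (∀ h : LocalGroup K (Sum.inr w), ρ₂ (localMap K (Sum.inr w) h) a₀ = a₀) ∧
        π • a₀ = (Polynomial.aeval (ρ₂ (localMap K (Sum.inl w) ((fun _ => (1 : LocalGroup K (Sum.inl w))) w)))
          ((fun w => Polynomial.C ((p : PowerSeries ℤ_[p]) ^ nI w)) w)) a := fun w hw a ha => by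
    obtain ⟨a₀, ha₀, h⟩ := hnI w hw a ha
    refine ⟨a₀, ha₀, ?_⟩
    rw [TelescopeK2WeightTwoControlMapOfFiniteDefect.aeval_C_apply]
    exact h
  -- (hunr) off `S₁` and (hrootsI), shared by the two applications below
  have hunr' : ∀ w : HeightOneSpectrum (𝓞 K), w ∉ S₁ →
      (Sum.inr w : LocalIndex K) ∈ strictSet p 𝔭bar (∅ : Set (HeightOneSpectrum (𝓞 K))) →
      ∀ (τ : LocalGroup K (Sum.inr w)) (a : A₂), ρ₂ (localMap K (Sum.inr w) τ) a = a := by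
    intro w hw hstrict τ a
    have hpw : ((p : ℕ) : 𝓞 K) ∉ w.asIdeal := ((inr_mem_strictSet_iff p 𝔭bar w (∅ : Set (HeightOneSpectrum (𝓞 K)))).1 hstrict).2
    have hwS₀ : w ∉ (S₀ : Set (HeightOneSpectrum (𝓞 K))) := fun h =>
      hw (Finset.mem_filter.2 ⟨Finset.mem_coe.1 h, hpw⟩)
    exact TelescopeK2WeightTwoControlMapOfInert.apply_localMap_inr_eq_self_of_isUnramifiedAt ρ₂ (hunr w hwS₀) τ a
  have hrootsI : ∀ w ∈ S₁, ∀ a : A₂, (∀ h : LocalGroup K (Sum.inr w), ρ₂ (localMap K (Sum.inr w) h) a = a) →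
      (∃ k : ℕ, p ^ k • a = 0) →
      (∃ a₀ : A₂, (∀ h : LocalGroup K (Sum.inr w), ρ₂ (localMap K (Sum.inr w) h) a₀ = a₀) ∧ π • a₀ = a) →
      ∃ b : A₂, (∀ h : LocalGroup K (Sum.inr w), ρ₂ (localMap K (Sum.inr w) h) b = b) ∧ (∃ k : ℕ, p ^ k • b = 0) ∧ π • b = a := by
    rintro w - a - - ⟨a₀, ha₀, hc⟩
    exact ⟨a₀, ha₀, hprim a₀, hc⟩
  -- the cokernel control with scalar `C(p^a) * ∏ C(p^{n_w})` (p751755)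
  obtain ⟨a, ha⟩ := TelescopeK2ControlOfFrobeniusData.smul_mem_map_torsionInclH1_selmer_of_frobeniusData κ ρ₂ 𝔭bar ∅ π htorπ hroot
    hsurj hfin𝔮 S₁ hunr' (fun _ => 1) (fun _ => 0) hN (fun w => Polynomial.C ((p : PowerSeries ℤ_[p]) ^ nI w)) hP hrootsI
  -- the control map `θ : Sel(M₂[C π]) → Sel(M₂)` (as in p751755) and its dual with kernel killed by the scalar
  have hmaps : ∀ y ∈ TorsionControl.selmer (localMap K) (strictSet p 𝔭bar (∅ : Set (HeightOneSpectrum (𝓞 K))))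
      (TorsionControl.torsionRep (AnticyclotomicBigGaloisRep κ ρ₂) (PowerSeries.C π : PowerSeries (PowerSeries ℤ_[p]))),
      TorsionControl.torsionInclH1 (AnticyclotomicBigGaloisRep κ ρ₂) (PowerSeries.C π : PowerSeries (PowerSeries ℤ_[p])) y ∈
        selmerBig κ ρ₂ 𝔭bar (∅ : Set (HeightOneSpectrum (𝓞 K))) :=
    fun y hy => TelescopeK2SelmerTorsionDefect.torsionInclH1_mem_selmer (localMap K) (strictSet p 𝔭bar (∅ : Set (HeightOneSpectrum (𝓞 K))))
      (AnticyclotomicBigGaloisRep κ ρ₂) (PowerSeries.C π : PowerSeries (PowerSeries ℤ_[p])) hy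
  let θ := (TorsionControl.torsionInclH1 (AnticyclotomicBigGaloisRep κ ρ₂) (PowerSeries.C π : PowerSeries (PowerSeries ℤ_[p]))).restrict hmaps
  have hθr : ∀ n, (PowerSeries.C π : PowerSeries (PowerSeries ℤ_[p])) • θ n = 0 := fun n => by
    apply Subtype.ext
    change (PowerSeries.C π : PowerSeries (PowerSeries ℤ_[p])) •
      TorsionControl.torsionInclH1 (AnticyclotomicBigGaloisRep κ ρ₂) (PowerSeries.C π : PowerSeries (PowerSeries ℤ_[p]))
        (n : continuousCohomology 1 (TorsionControl.torsionRep (AnticyclotomicBigGaloisRep κ ρ₂)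
          (PowerSeries.C π : PowerSeries (PowerSeries ℤ_[p]))).toTopRep) = 0
    rw [TorsionControl.torsionInclH1_apply]
    exact TorsionControl.smul_cohomologyMap_torsionIncl _ _ _
  have hker : Finite (LinearMap.ker θ) := by
    haveI := TelescopeK2ControlOfCoefficients.finite_ker_torsionInclH1_of_coefficients κ ρ₂ π htorπ hroot hfinK
    rw [LinearMap.ker_restrict]
    refine Finite.of_injective (fun y : Submodule.comap (Submodule.subtype _)
        (LinearMap.ker (TorsionControl.torsionInclH1 (AnticyclotomicBigGaloisRep κ ρ₂)
          (PowerSeries.C π : PowerSeries (PowerSeries ℤ_[p])))) =>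
      (⟨((y : TorsionControl.selmer (localMap K) (strictSet p 𝔭bar (∅ : Set (HeightOneSpectrum (𝓞 K))))
          (TorsionControl.torsionRep (AnticyclotomicBigGaloisRep κ ρ₂) (PowerSeries.C π : PowerSeries (PowerSeries ℤ_[p])))) :
            continuousCohomology 1 (TorsionControl.torsionRep (AnticyclotomicBigGaloisRep κ ρ₂)
              (PowerSeries.C π : PowerSeries (PowerSeries ℤ_[p]))).toTopRep), y.2⟩ :
        LinearMap.ker (TorsionControl.torsionInclH1 (AnticyclotomicBigGaloisRep κ ρ₂)
          (PowerSeries.C π : PowerSeries (PowerSeries ℤ_[p]))))) ?_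
    intro y z hyz
    apply Subtype.ext
    apply Subtype.ext
    exact congrArg (fun v : LinearMap.ker (TorsionControl.torsionInclH1 (AnticyclotomicBigGaloisRep κ ρ₂)
      (PowerSeries.C π : PowerSeries (PowerSeries ℤ_[p]))) => (v : continuousCohomology 1 (TorsionControl.torsionRep
        (AnticyclotomicBigGaloisRep κ ρ₂) (PowerSeries.C π : PowerSeries (PowerSeries ℤ_[p]))).toTopRep)) hyz
  set σ : PowerSeries (PowerSeries ℤ_[p]) := PowerSeries.C ((p : PowerSeries ℤ_[p]) ^ (a + ∑ w ∈ S₁, nI w)) with hσ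
  have hs : ∀ y : selmerBig κ ρ₂ 𝔭bar (∅ : Set (HeightOneSpectrum (𝓞 K))),
      (PowerSeries.C π : PowerSeries (PowerSeries ℤ_[p])) • y = 0 → σ • y ∈ LinearMap.range θ := by
    intro y hyc
    have hyc' : (PowerSeries.C π : PowerSeries (PowerSeries ℤ_[p])) •
        (y : continuousCohomology 1 (AnticyclotomicBigGaloisRep κ ρ₂).toTopRep) = 0 := by
      rw [← Submodule.coe_smul, hyc, Submodule.coe_zero]
    have hay := ha y y.2 hyc'
    rw [C_pow_mul_prod_aeval_C] at hay
    obtain ⟨z, hzS, hzy⟩ := Submodule.mem_map.1 hay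
    refine ⟨⟨z, hzS⟩, Subtype.ext ?_⟩
    rw [LinearMap.restrict_apply, Submodule.coe_smul]
    exact hzy
  obtain ⟨f, -, hkerf, hcok⟩ := TelescopeK2ControlTorsionDefect.exists_quotSMulTop_linearMap_torsionDefect
    (PowerSeries.C π : PowerSeries (PowerSeries ℤ_[p])) σ θ hθr hker hs
  refine ⟨f, ⟨a + ∑ w ∈ S₁, nI w, fun v hv => hkerf v hv⟩, fun v hv => ⟨σ, ?_, hkerf v hv⟩, hcok⟩
  exact not_C_X_sub_C_dvd_C_pow hx _

/-! ## §2 All but finitely many members -/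

/-- Bookkeeping: the fixed part under «all `τ` with `κ τ = 1`» is the fixed part under the subtype-indexed family. [folklore] -/
theorem forall_imp_iff_forall_subtype {G A : Type*} (P : G → Prop) (Q : G → A → Prop) (a : A) :
    (∀ τ : G, P τ → Q τ a) ↔ ∀ i : {τ : G // P τ}, Q i.1 a :=
  ⟨fun h i => h i.1 i.2, fun h τ hτ => h ⟨τ, hτ⟩⟩

set_option maxHeartbeats 800000 in
/-- **THE MEMBER CONTROL MAP EXISTS FOR ALL BUT FINITELY MANY MEMBERS.** `K` imaginary quadratic, `p ≠ 2`, `κ` anticyclotomic, `𝔭bar ∋ p`;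
`ρ₂` on a cofinitely generated, `p`-primary, `X`-power-torsion `A₂`; member points `x_k` (`‖x k‖ < 1`, injective on `𝒦`) with (cof_k) on `𝒦`;
(unr `S₀`); and the WEIGHT-TWO fixed part at `𝔭bar` finite. THEN for all but finitely many `k ∈ 𝒦` the conclusion of
`exists_memberControlMap_of_finiteDefects` holds at `x_k` (both per-member inputs are generic in `k`:
`TelescopeK2FixedTorsionGenericFibre.finite_setOf_not_finite_fixed_torsionBy` at `𝔭bar`,
`TelescopeK2InertiaDefectGenericFibre.finite_setOf_not_finite_inertiaDefect` at each of the finitely many `w ∈ S₀`).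
[cite: GreenbergLNM1716, §1 p. 61, §4 pp. 117, 123–125] [cite: JetchevSkinnerWan2017, §3.4, Lemma 3.4.1] [cite: Castella2018Erratum, Lemma 2.1] -/
theorem finite_setOf_not_memberControl
    (hK : IsImaginaryQuadratic K) (hp2 : p ≠ 2)
    (κ : ZpExtension K p) (hκ : κ.IsAnticyclotomic)
    (𝔭bar : HeightOneSpectrum (𝓞 K)) (h𝔭bar : ((p : ℕ) : 𝓞 K) ∈ 𝔭bar.asIdeal)
    [TopologicalSpace (PowerSeries ℤ_[p])] (A₂ : Type) [AddCommGroup A₂] [Module (PowerSeries ℤ_[p]) A₂]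
    [TopologicalSpace A₂] [DiscreteTopology A₂]
    (ρ₂ : ContinuousRep (absoluteGaloisGroup K) (PowerSeries ℤ_[p]) A₂)
    [TopologicalSpace (PowerSeries (PowerSeries ℤ_[p]))]
    [ContinuousSMul (PowerSeries (PowerSeries ℤ_[p])) (BigRepModule (PowerSeries ℤ_[p]) p A₂)]
    (hA : IsCofinitelyGenerated (PowerSeries ℤ_[p]) A₂)
    (htor : ∀ a : A₂, ∃ n : ℕ, (PowerSeries.X : PowerSeries ℤ_[p]) ^ n • a = 0)
    (hprim : ∀ a : A₂, ∃ k : ℕ, p ^ k • a = 0)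
    (x : ℕ → ℤ_[p]) (hx : ∀ k, ‖x k‖ < 1) (𝒦 : Set ℕ) (hinj : Set.InjOn x 𝒦)
    (hcof : ∀ k ∈ 𝒦, ∀ a : A₂, ∃ b : A₂, (PowerSeries.X - PowerSeries.C (x k)) • b = a)
    (S₀ : Finset (HeightOneSpectrum (𝓞 K))) (hunr : GaloisRep.IsUnramifiedOutside (S₀ : Set (HeightOneSpectrum (𝓞 K))) ρ₂)
    (hfin𝔮X : Set.Finite {a : A₂ | (PowerSeries.X : PowerSeries ℤ_[p]) • a = 0 ∧ ∀ τ : LocalGroup K (Sum.inl 𝔭bar),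
      κ (localMap K (Sum.inl 𝔭bar) τ) = 1 → ρ₂ (localMap K (Sum.inl 𝔭bar) τ) a = a}) :
    {k : ℕ | k ∈ 𝒦 ∧ ¬ ∃ α : QuotSMulTop (PowerSeries.C (PowerSeries.X - PowerSeries.C (x k) : PowerSeries ℤ_[p]))
          (XBig κ ρ₂ 𝔭bar (∅ : Set (HeightOneSpectrum (𝓞 K))))
        →ₗ[PowerSeries (PowerSeries ℤ_[p])]
        CharacterModule (TorsionControl.selmer (localMap K) (strictSet p 𝔭bar (∅ : Set (HeightOneSpectrum (𝓞 K))))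
          (TorsionControl.torsionRep (AnticyclotomicBigGaloisRep κ ρ₂)
            (PowerSeries.C (PowerSeries.X - PowerSeries.C (x k) : PowerSeries ℤ_[p])))),
      (∃ m : ℕ, ∀ v ∈ LinearMap.ker α, (PowerSeries.C ((p : PowerSeries ℤ_[p]) ^ m) : PowerSeries (PowerSeries ℤ_[p])) • v = 0) ∧
      (∀ v ∈ LinearMap.ker α, ∃ s : PowerSeries (PowerSeries ℤ_[p]),
        ¬ ((PowerSeries.C (PowerSeries.X - PowerSeries.C (x k) : PowerSeries ℤ_[p])) ∣ s) ∧ s • v = 0) ∧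
      Finite ((CharacterModule (TorsionControl.selmer (localMap K) (strictSet p 𝔭bar (∅ : Set (HeightOneSpectrum (𝓞 K))))
        (TorsionControl.torsionRep (AnticyclotomicBigGaloisRep κ ρ₂)
          (PowerSeries.C (PowerSeries.X - PowerSeries.C (x k) : PowerSeries ℤ_[p]))))) ⧸ LinearMap.range α)}.Finite := by
  classical
  -- `p`-primarity in the `Λ`-scalar form
  have hprim' : ∀ a : A₂, ∃ k : ℕ, (p : PowerSeries ℤ_[p]) ^ k • a = 0 := fun a => by
    obtain ⟨k, hk⟩ := hprim a
    exact ⟨k, by rw [← Nat.cast_pow, Nat.cast_smul_eq_nsmul, hk]⟩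
  -- the decomposition family at `𝔭bar` and its generic bad set
  let G𝔭 : {τ : LocalGroup K (Sum.inl 𝔭bar) // κ (localMap K (Sum.inl 𝔭bar) τ) = 1} → (A₂ →ₗ[PowerSeries ℤ_[p]] A₂) :=
    fun τ => ρ₂ (localMap K (Sum.inl 𝔭bar) τ.1)
  have hX' : Set.Finite {a : A₂ | (PowerSeries.X : PowerSeries ℤ_[p]) • a = 0 ∧ ∀ i, G𝔭 i a = a} := by
    refine hfin𝔮X.subset ?_
    rintro a ⟨ha, hg⟩
    exact ⟨ha, fun τ hτ => hg ⟨τ, hτ⟩⟩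
  have hB𝔭 := TelescopeK2FixedTorsionGenericFibre.finite_setOf_not_finite_fixed_torsionBy (p := p) hA G𝔭 hX' x hx 𝒦 hinj
  -- the inertia families at the ramified `w ∤ p` and their generic bad sets
  let GI : ∀ w : HeightOneSpectrum (𝓞 K), LocalGroup K (Sum.inr w) → (A₂ →ₗ[PowerSeries ℤ_[p]] A₂) :=
    fun w h => ρ₂ (localMap K (Sum.inr w) h)
  have hBI := fun w : HeightOneSpectrum (𝓞 K) =>
    TelescopeK2InertiaDefectGenericFibre.finite_setOf_not_finite_inertiaDefect (p := p) hA (GI w) x hx 𝒦 hinj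
  -- the union of the bad sets is finite
  refine ((hB𝔭.union (S₀.finite_toSet.biUnion fun w _ => hBI w)).subset ?_)
  rintro k ⟨hk, hbad⟩
  by_contra hgood
  rw [Set.mem_union, Set.mem_iUnion₂, not_or, not_exists] at hgood
  obtain ⟨hgood𝔭, hgoodI⟩ := hgood
  apply hbad
  -- the member fixed part at `𝔭bar`
  have hfin𝔮 : Set.Finite {a : A₂ | (PowerSeries.X - PowerSeries.C (x k)) • a = 0 ∧ ∀ τ : LocalGroup K (Sum.inl 𝔭bar),
      κ (localMap K (Sum.inl 𝔭bar) τ) = 1 → ρ₂ (localMap K (Sum.inl 𝔭bar) τ) a = a} := by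
    have h1 : Set.Finite {a : A₂ | (PowerSeries.X - PowerSeries.C (x k) : PowerSeries ℤ_[p]) • a = 0 ∧ ∀ i, G𝔭 i a = a} := by
      by_contra h
      exact hgood𝔭 ⟨hk, h⟩
    refine h1.subset ?_
    rintro a ⟨ha, hg⟩
    exact ⟨ha, fun i => hg i.1 i.2⟩
  -- the member inertia defects at every ramified `w ∤ p`
  have hfinI : ∀ w ∈ S₀, ((p : ℕ) : 𝓞 K) ∉ w.asIdeal →
      ∃ n : ℕ, ∀ a : A₂, (∀ h : LocalGroup K (Sum.inr w), ρ₂ (localMap K (Sum.inr w) h) a = a) →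
        ∃ a₀ : A₂, (∀ h : LocalGroup K (Sum.inr w), ρ₂ (localMap K (Sum.inr w) h) a₀ = a₀) ∧
          (PowerSeries.X - PowerSeries.C (x k)) • a₀ = ((p : PowerSeries ℤ_[p]) ^ n) • a := by
    intro w hw _
    have h1 : Finite (QuotSMulTop (PowerSeries.X - PowerSeries.C (x k) : PowerSeries ℤ_[p])
        (↥(⨅ i, LinearMap.ker (GI w i - LinearMap.id) : Submodule (PowerSeries ℤ_[p]) A₂))) := by
      by_contra h
      exact hgoodI w ⟨Finset.mem_coe.2 hw, ⟨hk, h⟩⟩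
    haveI := h1
    obtain ⟨n, hn⟩ := TelescopeK2InertiaDefectFiniteOfFibres.exists_pow_smul_eq_of_finite_quotient (p : PowerSeries ℤ_[p]) hprim'
      (⨅ i, LinearMap.ker (GI w i - LinearMap.id)) (PowerSeries.X - PowerSeries.C (x k))
    refine ⟨n, fun a ha => ?_⟩
    obtain ⟨a₀, ha₀, h⟩ := hn a ((TelescopeK2InertiaDefectGenericFibre.mem_iInf_ker_sub_id_iff (GI w) a).2 ha)
    exact ⟨a₀, (TelescopeK2InertiaDefectGenericFibre.mem_iInf_ker_sub_id_iff (GI w) a₀).1 ha₀, h⟩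
  exact exists_memberControlMap_of_finiteDefects hK hp2 κ hκ 𝔭bar h𝔭bar A₂ ρ₂ htor hprim (hx k) (hcof k hk) S₀ hunr hfin𝔮 hfinI

/-! ## §3 Road-prefix currency (Cell C) -/

set_option maxHeartbeats 800000 in
/-- **MEMBER CONTROL FOR ALL BUT FINITELY MANY `k` ON CELL C**, in the binder currency of the N2/N3′ texts: `CellC W p`, `K` imaginary
quadratic, `p` split in `K`, `κ` anticyclotomic, `𝔭bar ∋ p`, N1's (tor)/(cof_k on `𝒦`)/(unr `S₀`, any finite set)/(fd₀ `θ₀`: `ℤ_p`-semilinear,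
equivariant, finite kernel) and member points `x` injective on `𝒦`: §2 with the weight-two fixed part at `𝔭bar` supplied by x2-p2 g20's
`TelescopeK2FixedTorsionFiniteMult.finite_fixed_torsionBy_local_of_mult` ((μ) by `TelescopeK2InertiaMovesRootsOfUnity`) and cofinite generation
by `TelescopeK2FibreCofinite.isCofinitelyGenerated_of_fd`. [cite: JetchevSkinnerWan2017, §3.4, Lemma 3.4.1] [cite: SilvermanATAEC1994, Thm. V.5.3, Cor. V.5.4]
[cite: GreenbergLNM1716, §4 pp. 117, 123–125] [cite: Brink2007, Cor. 1] -/
theorem finite_setOf_not_memberControl_of_cellC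
    (W : WeierstrassCurve ℚ) [W.IsElliptic] [W.IsGloballyMinimal] (hc : Rank1Residual.X2.CellC W p)
    (hK : IsImaginaryQuadratic K) (hsp : ((Ideal.span {(p : ℤ)}).primesOver (𝓞 K)).ncard = 2)
    (κ : ZpExtension K p) (hκ : κ.IsAnticyclotomic)
    (𝔭bar : HeightOneSpectrum (𝓞 K)) (h𝔭bar : ((p : ℕ) : 𝓞 K) ∈ 𝔭bar.asIdeal)
    [TopologicalSpace (PowerSeries ℤ_[p])] (A₂ : Type) [AddCommGroup A₂] [Module (PowerSeries ℤ_[p]) A₂]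
    [TopologicalSpace A₂] [DiscreteTopology A₂]
    (ρ₂ : ContinuousRep (absoluteGaloisGroup K) (PowerSeries ℤ_[p]) A₂)
    [TopologicalSpace (PowerSeries (PowerSeries ℤ_[p]))]
    [ContinuousSMul (PowerSeries (PowerSeries ℤ_[p])) (BigRepModule (PowerSeries ℤ_[p]) p A₂)]
    (htor : ∀ a : A₂, ∃ n : ℕ, (PowerSeries.X : PowerSeries ℤ_[p]) ^ n • a = 0)
    (x : ℕ → ℤ_[p]) (hx : ∀ k, ‖x k‖ < 1) (𝒦 : Set ℕ) (hinj : Set.InjOn x 𝒦)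
    (hcof : ∀ k ∈ 𝒦, ∀ a : A₂, ∃ b : A₂, (PowerSeries.X - PowerSeries.C (x k)) • b = a)
    (S₀ : Set (HeightOneSpectrum (𝓞 K))) (hS₀ : S₀.Finite) (hunr : GaloisRep.IsUnramifiedOutside S₀ ρ₂)
    (θ₀ : Submodule.torsionBy (PowerSeries ℤ_[p]) A₂ (PowerSeries.X : PowerSeries ℤ_[p]) →+
      PrimaryTorsion (W.baseChange K).geomPoints p)
    (hθ₀ : ∀ (c : ℤ_[p]) (a : Submodule.torsionBy (PowerSeries ℤ_[p]) A₂ (PowerSeries.X : PowerSeries ℤ_[p])),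
      θ₀ (PowerSeries.C c • a) = c • θ₀ a)
    (hθσ : ∀ (σ : absoluteGaloisGroup K)
      (a : Submodule.torsionBy (PowerSeries ℤ_[p]) A₂ (PowerSeries.X : PowerSeries ℤ_[p])),
      θ₀ (BigGaloisRep.torsionRep ρ₂ (PowerSeries.X : PowerSeries ℤ_[p]) σ a) =
        (W.baseChange K).primaryTorsionGaloisRep p σ (θ₀ a))
    (hker : Finite θ₀.ker) :
    {k : ℕ | k ∈ 𝒦 ∧ ¬ ∃ α : QuotSMulTop (PowerSeries.C (PowerSeries.X - PowerSeries.C (x k) : PowerSeries ℤ_[p]))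
          (XBig κ ρ₂ 𝔭bar (∅ : Set (HeightOneSpectrum (𝓞 K))))
        →ₗ[PowerSeries (PowerSeries ℤ_[p])]
        CharacterModule (TorsionControl.selmer (localMap K) (strictSet p 𝔭bar (∅ : Set (HeightOneSpectrum (𝓞 K))))
          (TorsionControl.torsionRep (AnticyclotomicBigGaloisRep κ ρ₂)
            (PowerSeries.C (PowerSeries.X - PowerSeries.C (x k) : PowerSeries ℤ_[p])))),
      (∃ m : ℕ, ∀ v ∈ LinearMap.ker α, (PowerSeries.C ((p : PowerSeries ℤ_[p]) ^ m) : PowerSeries (PowerSeries ℤ_[p])) • v = 0) ∧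
      (∀ v ∈ LinearMap.ker α, ∃ s : PowerSeries (PowerSeries ℤ_[p]),
        ¬ ((PowerSeries.C (PowerSeries.X - PowerSeries.C (x k) : PowerSeries ℤ_[p])) ∣ s) ∧ s • v = 0) ∧
      Finite ((CharacterModule (TorsionControl.selmer (localMap K) (strictSet p 𝔭bar (∅ : Set (HeightOneSpectrum (𝓞 K))))
        (TorsionControl.torsionRep (AnticyclotomicBigGaloisRep κ ρ₂)
          (PowerSeries.C (PowerSeries.X - PowerSeries.C (x k) : PowerSeries ℤ_[p]))))) ⧸ LinearMap.range α)}.Finite := by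
  classical
  have hp2 : p ≠ 2 := hc.2.1
  have hmult : W.HasMultiplicativeReductionAtPrime p := hc.2.2.2
  obtain ⟨he, hf⟩ := degreeOne_of_splitsIn hK.1 hsp h𝔭bar
  -- `p`-primarity and cofinite generation from (tor) + (fd₀)
  have hPT : ∀ e : PrimaryTorsion (W.baseChange K).geomPoints p, IsOfFinAddOrder e := fun e => by
    obtain ⟨k, hk⟩ := PrimaryTorsion.exists_pow_smul_eq_zero e
    refine (isOfFinAddOrder_iff_nsmul_eq_zero).2 ⟨p ^ k, pow_pos (Nat.Prime.pos Fact.out) k, ?_⟩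
    apply PrimaryTorsion.ext
    rw [PrimaryTorsion.val_nsmul, hk, PrimaryTorsion.val_zero]
  have htors : ∀ a : A₂, IsOfFinAddOrder a :=
    TelescopeK2BigRepDivisible.isOfFinAddOrder_of_pow_torsion PowerSeries.X htor
      (TelescopeK2BigRepDivisible.isOfFinAddOrder_of_torsionBy PowerSeries.X θ₀ hker hPT)
  have hprim : ∀ a : A₂, ∃ k : ℕ, p ^ k • a = 0 := fun a =>
    TelescopeK2WeightTwoControlMapOfFrobenius.exists_pow_smul_eq_zero_of_isOfFinAddOrder (htors a)
  have hpK : (p : K) ≠ 0 := Nat.cast_ne_zero.2 (Nat.Prime.ne_zero Fact.out)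
  have hA : IsCofinitelyGenerated (PowerSeries ℤ_[p]) A₂ :=
    TelescopeK2FibreCofinite.isCofinitelyGenerated_of_fd TelescopeK2FibreCofinite.primaryTorsion_exists_pow_smul_eq_zero
      (TelescopeK2FibreCofinite.finite_torsionBy_primaryTorsion_geomPoints (W.baseChange K) hpK) htor θ₀ hθ₀ hker
  -- the weight-two fixed part at `𝔭bar` (x2-p2 g20)
  obtain ⟨s, hsurj⟩ :=
    AnticyclotomicLocalImage.anticyclotomic_exists_forall_exists_toAdd_eq_pow_mul hK hp2 κ hκ 𝔭bar h𝔭bar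
  have hμ : ∀ ζ : AlgebraicClosure (𝔭bar.adicCompletion K),
      (∀ σ ∈ absInertia (𝔭bar.adicCompletion K), σ • ζ = ζ) → ζ ^ p = 1 → ζ = 1 := fun ζ hfix hζ =>
    TelescopeK2InertiaMovesRootsOfUnity.eq_one_of_pow_prime_eq_one_of_forall_absInertia hp2 𝔭bar h𝔭bar he hf ζ hfix hζ
  have hfinloc := TelescopeK2FixedTorsionFiniteMult.finite_fixed_torsionBy_local_of_mult W κ ρ₂ PowerSeries.X θ₀
    hp2 hmult 𝔭bar h𝔭bar he hf hsurj hμ hθσ hker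
  have hcoe : ((hS₀.toFinset : Finset (HeightOneSpectrum (𝓞 K))) : Set (HeightOneSpectrum (𝓞 K))) = S₀ := hS₀.coe_toFinset
  exact finite_setOf_not_memberControl hK hp2 κ hκ 𝔭bar h𝔭bar A₂ ρ₂ hA htor hprim x hx 𝒦 hinj hcof hS₀.toFinset
    (by rw [hcoe]; exact hunr) hfinloc

end Summit.BirchSwinnertonDyer.BirchSwinnertonDyer.Theorems.TelescopeK2MemberControlMapEventually

end
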